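import Summits.QuantumFields.YangMills.Theorems.LangevinControlUVOSLegsFromFemtoAndGapStubAssemblyLatticeDist
import HarnessLib

/-!
# Crux `ROT` (stmt-QuantumFields-20042): Wilson's lattice gauge theory on a SKEW torus `ℤᵈ/P` and its `n`-point distribution

Helper file of cell `ym-beyond`, seat p4 (generation g18), `--supports stmt-QuantumFields-20042 --as helper`.

WHY.  Caveat (iii′) of the rev-2′ rotation leg (N-ROT-NODE-MEMO v2 §5, ym-beyond-p4 g17; acknowledged by the fleet lead
`ym-spine-20042-p1` g2 FINAL, `FINDING-20042-IR-guard.md` v3): King's two-orientation comparison (C. King, Commun. Math. Phys. **103**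
(1986) 323–349, II (2.24)–(2.25)) compares the axis Wilson theory on the STRAIGHT torus `ℝ⁴/aNℤ⁴` with the axis Wilson theory on the
TILTED torus `ℝ⁴/R_θ(aNℤ⁴)`; in lattice units the latter is Wilson's theory on the quotient `ℤ⁴/P`, `P = N·R_θ⁻¹ℤ⁴ ∩ ℤ⁴`
(`= N·(qR_θ)⁻¹… ` for a Pythagorean angle of modulus `q ∣ N`), which is NOT of the form `(ℤ/Nℤ)⁴`.  The tree's `wilsonMeasure` /
`wilsonTorusMean` / `latticeDist` are hard-wired to the axis torus `Fin d → ZMod L`, so the tilt-insensitivity input `TI` and the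
leg-1 node `N-ROT.3` were "not expressible" (fleet FINAL 2026-08-26T18:13Z).  This file makes them expressible:

* `PeriodCell d` — a period lattice `P ≤ ℤᵈ` given together with a finite transversal `reps` and a reduction map `red`
  (no quotient types, no instances: the sites of `ℤᵈ/P` ARE the representatives);
* Wilson's theory on the cell: `Config`, `holonomy`, `action`, `weight`, `partitionZ`, `measure` — VERBATIM the formulas of
  `ConstructiveQFTWave0` (`plaquetteHolonomy`, `wilsonAction`, `wilsonWeight`, `partitionFunction`, `wilsonMeasure`) with the
  neighbour map `x ↦ red (x + eᵢ)`;
* the periodic lift `lift : Config → LGConfig d G` (`configShift p (lift U) = lift U` for `p ∈ P`), the centred moments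
  `moment` (VERBATIM `torusMoment` through the lift) and the mean `mean` (VERBATIM `wilsonTorusMean`);
* the `n`-point distribution `dist ρ β A O m n : 𝓢((Fin n → ℝᵈ), ℂ) →L[ℂ] ℂ`, `F ↦ ∑_{x ∈ repsⁿ} W(x) F(A x₁, …, A xₙ)` for an
  arbitrary embedding `A : ℤᵈ → ℝᵈ` of the sites (VERBATIM `latticeDist`, whose embedding is `x ↦ a x`), and its EXACT covariance
  `dist (L ∘ A) (linActMulti L F) = dist A F` for every linear isometry `L` (`dist_linActMulti`) — the reindexing-free identity
  that splits King's finite-angle defect into a regularisation-comparison bracket and a tilt bracket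
  (`Theorems/BalabanLadderROTTiltSplit.lean`).

Nothing here is specific to `d = 4` or to rotations; nothing is asserted about Yang–Mills.  No instance, no named fact, no sorry.
References: K. Wilson, Phys. Rev. D **10** (1974) 2445; E. Seiler, LNP **159** (1982) Ch. 2 (periodic b.c.); C. King, CMP **103** (1986) §2.
-/

set_option autoImplicit false

noncomputable section

open scoped SchwartzMap BigOperators ENNReal
open MeasureTheory Filter Topology
open Literature.MathematicalPhysics.QuantumFieldTheory Literature.MathematicalPhysics.QuantumLattice
open Literature.MathematicalPhysics.AQFT
open Literature.Probability.LatticeModels (box Site)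

namespace Summit.QuantumFields.YangMills.Theorems.ROT

/-- **A period cell of `ℤᵈ`**: a period lattice `P` (an additive subgroup), a finite set of representatives `reps` and a
reduction `red : ℤᵈ → ℤᵈ` onto `reps` along `P` (`red x ∈ reps`, `red x - x ∈ P`, `red` fixes `reps` and is `P`-periodic).
These axioms make `reps` a transversal of `P` (`red_eq_red_iff`), so `P` has finite index and `reps` models the skew torus `ℤᵈ/P`. -/
structure PeriodCell (d : ℕ) where
  /-- the period lattice -/
  P : AddSubgroup (Site d)
  /-- a finite transversal: the sites of the skew torus -/
  reps : Finset (Site d)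
  /-- reduction to the representative -/
  red : Site d → Site d
  red_mem : ∀ x, red x ∈ reps
  red_eq_self : ∀ x ∈ reps, red x = x
  red_sub_mem : ∀ x, red x - x ∈ P
  red_add : ∀ x p, p ∈ P → red (x + p) = red x

namespace PeriodCell

variable {d : ℕ} (C : PeriodCell d)

/-! ## §1 Reduction -/

/-- Reduction is idempotent. [folklore] -/
theorem red_red (x : Site d) : C.red (C.red x) = C.red x :=
  C.red_eq_self _ (C.red_mem x)

/-- Two sites have the same representative iff they differ by a period. -/
theorem red_eq_red_iff (x y : Site d) : C.red x = C.red y ↔ x - y ∈ C.P := by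
  constructor
  · intro h
    have h1 := C.red_sub_mem x
    have h2 := C.red_sub_mem y
    have : x - y = (C.red y - y) - (C.red x - x) := by rw [h]; abel
    rw [this]
    exact C.P.sub_mem h2 h1
  · intro h
    have : x = y + (x - y) := by abel
    rw [this, C.red_add _ _ h]

/-- Reduction is invariant under subtracting a period. [folklore] -/
theorem red_sub_of_mem (x p : Site d) (hp : p ∈ C.P) : C.red (x - p) = C.red x := by
  rw [sub_eq_add_neg, C.red_add _ _ (C.P.neg_mem hp)]

/-- Reduction is invariant under adding a period on the left. [folklore] -/
theorem red_add_left_of_mem (p x : Site d) (hp : p ∈ C.P) : C.red (p + x) = C.red x := by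
  rw [add_comm, C.red_add _ _ hp]

/-- Distinct representatives are incongruent. -/
theorem eq_of_mem_reps_of_sub_mem {x y : Site d} (hx : x ∈ C.reps) (hy : y ∈ C.reps) (h : x - y ∈ C.P) : x = y := by
  rw [← C.red_eq_self x hx, ← C.red_eq_self y hy]
  exact (C.red_eq_red_iff x y).2 h

/-! ## §2 The skew torus: sites, edges, plaquettes, configurations -/

/-- Sites of the skew torus `ℤᵈ/P`, realised as the representatives. -/
abbrev TSite : Type := ↥C.reps

/-- Positively oriented edges `(x, i)`: from `x` to `red (x + eᵢ)`. -/
abbrev TEdge : Type := C.TSite × Fin d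

/-- Plaquettes `(x, ⟨(i, j), i < j⟩)`. -/
abbrev TPlaq : Type := C.TSite × {p : Fin d × Fin d // p.1 < p.2}

/-- Gauge configurations of the skew torus. -/
abbrev Config (G : Type*) : Type _ := C.TEdge → G

/-- The representative of a site of `ℤᵈ`, as a site of the skew torus. -/
def toRep (x : Site d) : C.TSite := ⟨C.red x, C.red_mem x⟩

/-- The representative, coerced back to `ℤᵈ`, is the reduction. [folklore] -/
@[simp] theorem coe_toRep (x : Site d) : (C.toRep x : Site d) = C.red x := rfl

/-- Two sites have the same torus site iff they differ by a period. [folklore] -/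
theorem toRep_eq_toRep_iff (x y : Site d) : C.toRep x = C.toRep y ↔ x - y ∈ C.P := by
  rw [← C.red_eq_red_iff, toRep, toRep, Subtype.mk.injEq]

/-- Adding a period does not change the torus site. [folklore] -/
theorem toRep_add_of_mem (x p : Site d) (hp : p ∈ C.P) : C.toRep (x + p) = C.toRep x :=
  Subtype.ext (C.red_add x p hp)

/-- Subtracting a period does not change the torus site. [folklore] -/
theorem toRep_sub_of_mem (x p : Site d) (hp : p ∈ C.P) : C.toRep (x - p) = C.toRep x :=
  Subtype.ext (C.red_sub_of_mem x p hp)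

/-- A representative is its own torus site. [folklore] -/
theorem toRep_coe (x : C.TSite) : C.toRep (x : Site d) = x :=
  Subtype.ext (C.red_eq_self _ x.2)

/-- The neighbour `red (x + eᵢ)` of a site of the skew torus. -/
def shift (x : C.TSite) (i : Fin d) : C.TSite := C.toRep ((x : Site d) + Pi.single i 1)

variable {G : Type*} [Group G]

/-- Plaquette holonomy `U(x,i) U(x+eᵢ,j) U(x+eⱼ,i)⁻¹ U(x,j)⁻¹` on the skew torus (VERBATIM `plaquetteHolonomy`). -/
def holonomy (U : C.Config G) (x : C.TSite) (i j : Fin d) : G :=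
  U (x, i) * U (C.shift x i, j) * (U (C.shift x j, i))⁻¹ * (U (x, j))⁻¹

variable {N : ℕ} (ρ : G →* Matrix (Fin N) (Fin N) ℂ)

/-- Wilson's action `∑ₚ (N − Re tr ρ(U_p))` on the skew torus (VERBATIM `wilsonAction`). -/
def action (U : C.Config G) : ℝ :=
  ∑ p : C.TPlaq, ((N : ℝ) - (ρ (C.holonomy U p.1 p.2.1.1 p.2.1.2)).trace.re)

variable [TopologicalSpace G] [IsTopologicalGroup G] [CompactSpace G] [MeasurableSpace G] [BorelSpace G]

/-- The Wilson weight `exp(−β S(U)) ∏ₑ dU_e` on the skew torus (VERBATIM `wilsonWeight`). -/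
def weight (β : ℝ) : Measure (C.Config G) :=
  (Measure.pi fun _ : C.TEdge => haarProbability G).withDensity
    fun U => ENNReal.ofReal (Real.exp (-β * C.action ρ U))

/-- The partition function of the skew torus (VERBATIM `partitionFunction`). -/
def partitionZ (β : ℝ) : ℝ≥0∞ :=
  C.weight (G := G) ρ β Set.univ

/-- Wilson's probability measure on the skew torus (VERBATIM `wilsonMeasure`). -/
def measure (β : ℝ) : Measure (C.Config G) :=
  (C.partitionZ (G := G) ρ β)⁻¹ • C.weight ρ β

omit [IsTopologicalGroup G] [MeasurableSpace G] [BorelSpace G] in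
/-- The Wilson action of the (finite) skew torus is bounded, for a continuous representation. -/
theorem exists_abs_action_le (hρ : Continuous ρ) : ∃ B : ℝ, ∀ U : C.Config G, |C.action ρ U| ≤ B := by
  obtain ⟨M, -, hM⟩ := exists_bound_trace_re_nonneg ρ hρ
  refine ⟨∑ _p : C.TPlaq, ((N : ℝ) + M), fun U => ?_⟩
  unfold action
  refine (Finset.abs_sum_le_sum_abs _ _).trans (Finset.sum_le_sum fun p _ => ?_)
  refine (abs_sub _ _).trans ?_
  rw [Nat.abs_cast]
  exact add_le_add le_rfl (hM _)

/-- For a continuous representation Wilson's measure on the skew torus is a probability measure (`0 < Z < ∞`). -/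
theorem isProbabilityMeasure_measure (hρ : Continuous ρ) (β : ℝ) : IsProbabilityMeasure (C.measure (G := G) ρ β) := by
  obtain ⟨B, hB⟩ := C.exists_abs_action_le ρ hρ
  set π : Measure (C.Config G) := Measure.pi fun _ : C.TEdge => haarProbability G with hπ
  have hZ : C.partitionZ (G := G) ρ β = ∫⁻ U, ENNReal.ofReal (Real.exp (-β * C.action ρ U)) ∂π := by
    simp only [partitionZ, weight, withDensity_apply _ MeasurableSet.univ, Measure.restrict_univ, hπ]
  have hbound : ∀ U : C.Config G, |β * C.action ρ U| ≤ |β| * B := fun U => by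
    rw [abs_mul]; exact mul_le_mul_of_nonneg_left (hB U) (abs_nonneg _)
  have hlow : ENNReal.ofReal (Real.exp (-(|β| * B))) ≤ C.partitionZ (G := G) ρ β := by
    rw [hZ]
    calc ENNReal.ofReal (Real.exp (-(|β| * B)))
        = ∫⁻ _U, ENNReal.ofReal (Real.exp (-(|β| * B))) ∂π := by
          rw [lintegral_const, measure_univ, mul_one]
      _ ≤ _ := lintegral_mono fun U => ENNReal.ofReal_le_ofReal (Real.exp_le_exp.2 (by
          have := (abs_le.1 (hbound U)).2
          linarith))
  have hup : C.partitionZ (G := G) ρ β ≤ ENNReal.ofReal (Real.exp (|β| * B)) := by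
    rw [hZ]
    calc _ ≤ ∫⁻ _U, ENNReal.ofReal (Real.exp (|β| * B)) ∂π :=
          lintegral_mono fun U => ENNReal.ofReal_le_ofReal (Real.exp_le_exp.2 (by
            have := (abs_le.1 (hbound U)).1
            linarith))
      _ = _ := by rw [lintegral_const, measure_univ, mul_one]
  have h0 : C.partitionZ (G := G) ρ β ≠ 0 :=
    (lt_of_lt_of_le (ENNReal.ofReal_pos.2 (Real.exp_pos _)) hlow).ne'
  have htop : C.partitionZ (G := G) ρ β ≠ ⊤ := ne_top_of_le_ne_top ENNReal.ofReal_ne_top hup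
  constructor
  simp only [measure, Measure.smul_apply, smul_eq_mul]
  exact ENNReal.inv_mul_cancel h0 htop

/-! ## §3 The periodic lift and the centred moments -/

omit [Group G] [TopologicalSpace G] [IsTopologicalGroup G] [CompactSpace G] [MeasurableSpace G] [BorelSpace G] in
/-- The `P`-periodic lift of a skew-torus configuration to `ℤᵈ`: `(lift U)(x, i) = U(red x, i)` (VERBATIM `torusLift`). -/
def lift (U : C.Config G) : LGConfig d G := fun e => U (C.toRep e.1, e.2)

omit [Group G] [TopologicalSpace G] [IsTopologicalGroup G] [CompactSpace G] [MeasurableSpace G] [BorelSpace G] in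
/-- Unfolding the periodic lift: `lift U (x, i) = U (toRep x, i)`. [folklore] -/
@[simp] theorem lift_apply (U : C.Config G) (e : Site d × Fin d) : C.lift U e = U (C.toRep e.1, e.2) := rfl

omit [Group G] [TopologicalSpace G] [IsTopologicalGroup G] [CompactSpace G] [BorelSpace G] in
/-- The lift is `P`-periodic. -/
theorem configShift_lift_of_mem (p : Site d) (hp : p ∈ C.P) (U : C.Config G) : configShift p (C.lift U) = C.lift U := by
  funext e
  rw [configShift_apply, lift_apply, lift_apply, C.toRep_sub_of_mem _ _ hp]

omit [Group G] [TopologicalSpace G] [IsTopologicalGroup G] [CompactSpace G] [BorelSpace G] in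
/-- Translates of the lift by congruent vectors agree. -/
theorem configShift_neg_lift_eq_of_sub_mem {x y : Site d} (h : x - y ∈ C.P) (U : C.Config G) :
    configShift (-x) (C.lift U) = configShift (-y) (C.lift U) := by
  funext e
  rw [configShift_apply, configShift_apply, lift_apply, lift_apply, sub_neg_eq_add, sub_neg_eq_add]
  congr 2
  exact (C.toRep_eq_toRep_iff _ _).2 (by rwa [add_sub_add_left_eq_sub])

/-- **Skew-torus Wilson mean** `∫ O(Ũ) dμ` of an observable of the infinite lattice, through the periodic lift (VERBATIM
`wilsonTorusMean`). -/
def mean (β : ℝ) (O : LGConfig d G → ℝ) : ℝ :=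
  ∫ U, O (C.lift U) ∂(C.measure (G := G) ρ β)

/-- **Centred skew-torus `n`-point moment** `W(x) = ∫ ∏ᵢ (O(τ_{xᵢ} Ũ) − m) dμ(U)` (VERBATIM `torusMoment`). -/
def moment (β : ℝ) (O : LGConfig d G → ℝ) (m : ℝ) {n : ℕ} (x : Fin n → Site d) : ℝ :=
  ∫ U, ∏ i, (O (configShift (-(x i)) (C.lift U)) - m) ∂(C.measure (G := G) ρ β)

/-- The moments are `P`-periodic in every argument. -/
theorem moment_eq_of_sub_mem (β : ℝ) (O : LGConfig d G → ℝ) (m : ℝ) {n : ℕ} {x y : Fin n → Site d}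
    (h : ∀ i, x i - y i ∈ C.P) : C.moment (G := G) ρ β O m x = C.moment ρ β O m y := by
  unfold moment
  refine integral_congr_ae (Eventually.of_forall fun U => ?_)
  refine Finset.prod_congr rfl fun i _ => ?_
  rw [C.configShift_neg_lift_eq_of_sub_mem (h i)]

/-! ## §4 The `n`-point distribution with an arbitrary site embedding, and its covariance -/

/-- **The skew-torus `n`-point distribution** of the observable `O` with site embedding `A : ℤᵈ → ℝᵈ`: the finite atomic functional
`F ↦ ∑_{x ∈ repsⁿ} W(x) F(A x₁, …, A xₙ)` on `𝓢((Fin n → ℝᵈ), ℂ)` (VERBATIM `latticeDist`, which is the axis torus with `A x = a x`). -/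
def dist (β : ℝ) (A : Site d → EuclideanSpace ℝ (Fin d)) (O : LGConfig d G → ℝ) (m : ℝ) (n : ℕ) :
    𝓢((Fin n → EuclideanSpace ℝ (Fin d)), ℂ) →L[ℂ] ℂ :=
  ∑ x ∈ Fintype.piFinset (fun _ : Fin n => C.reps),
    ((C.moment (G := G) ρ β O m x : ℝ) : ℂ) • LabelledSchwingerFamily.evalAt (fun i => A (x i))

/-- Unfolding `dist`. -/
theorem dist_apply (β : ℝ) (A : Site d → EuclideanSpace ℝ (Fin d)) (O : LGConfig d G → ℝ) (m : ℝ) (n : ℕ)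
    (F : 𝓢((Fin n → EuclideanSpace ℝ (Fin d)), ℂ)) :
    C.dist (G := G) ρ β A O m n F =
      ∑ x ∈ Fintype.piFinset (fun _ : Fin n => C.reps), ((C.moment (G := G) ρ β O m x : ℝ) : ℂ) * F (fun i => A (x i)) := by
  simp only [dist, FunLike.coe_sum, Finset.sum_apply, FunLike.coe_smul, Pi.smul_apply,
    LabelledSchwingerFamily.evalAt_apply, smul_eq_mul]

/-- **Exact covariance of the skew-torus distribution**: transporting the embedding by a linear isometry `L` and the test function
by its diagonal action changes nothing — `dist (L ∘ A) (linActMulti L F) = dist A F`.  (No reindexing of sites is involved: the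
moments `W(x)` are untouched; only `F(L⁻¹ L A x) = F(A x)`.) -/
theorem dist_linActMulti (β : ℝ) (A : Site d → EuclideanSpace ℝ (Fin d)) (O : LGConfig d G → ℝ) (m : ℝ) (n : ℕ)
    (L : EuclideanSpace ℝ (Fin d) ≃ₗᵢ[ℝ] EuclideanSpace ℝ (Fin d)) (F : 𝓢((Fin n → EuclideanSpace ℝ (Fin d)), ℂ)) :
    C.dist (G := G) ρ β (fun x => L (A x)) O m n (linActMulti L F) = C.dist (G := G) ρ β A O m n F := by
  rw [dist_apply, dist_apply]
  refine Finset.sum_congr rfl fun x _ => ?_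
  rw [linActMulti_apply]
  simp only [LinearIsometryEquiv.symm_apply_apply]

/-- The distribution is linear in the test function (it is a continuous linear map); recorded for the defect algebra. -/
theorem dist_sub (β : ℝ) (A : Site d → EuclideanSpace ℝ (Fin d)) (O : LGConfig d G → ℝ) (m : ℝ) (n : ℕ)
    (F F' : 𝓢((Fin n → EuclideanSpace ℝ (Fin d)), ℂ)) :
    C.dist (G := G) ρ β A O m n (F - F') = C.dist (G := G) ρ β A O m n F - C.dist (G := G) ρ β A O m n F' :=
  map_sub _ _ _

end PeriodCell

end Summit.QuantumFields.YangMills.Theorems.ROT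

end
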